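import Summits.Schanuel.Schanuel.Theorems.SoloInformedRoyLiouvilleValue

/-!
# Condition (b) of Roy's criterion fails at algebraic points; Hermite–Lindemann through Roy

**Theorem (S2(b) of the solo-informed atlas).** Let `y₀ ≠ 0`, `α₀ ≠ 0` lie in a number field `K`,
`σ : K → ℂ`. For parameters with `0 ≤ t₀, t₁`, `t₀ + t₁ < s₀ + s₁`, (`σα₀` non-torsion or
`t₁ < s₀`) and `u > max{1, s₀, t₀, s₁ + t₁}`, condition (b) of Roy's Theorem 1 FAILS at
`(σy₀, σα₀)`: `not_royConditionB_of_numberField`. In particular it fails for every admissible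
parameter set of Roy's Theorem 1 (`not_royConditionB_of_numberField_admissible`).

Proof: by `roy_no_exact_witness` (Philippon's zero estimate) a witness `Q_N` of (b) has a value
`x = (D^k Q_N)(m σy₀, σα₀^m)` with `0 < |x| ≤ e^{-N^u}`; by Liouville's inequality
(`royD_value_liouville`) `|x| ≥ exp(-[K:ℚ](A₁ + A₂))` with
`A₁ + A₂ = O(N^{t₀} + N^{s₁+t₁} + N^{s₀} log N + N + N^{t₀} log N) = o(N^u)`. The threshold
`u > max{1, s₀, t₀, s₁ + t₁}` of this direct argument is EXACTLY the lower bound for `u` in Roy's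
Proposition 2 / condition (1): below it Waldschmidt's construction is not available, above it
Liouville's inequality already decides (b) at algebraic points (transcendence degree `0`).

**Corollary (Hermite–Lindemann through Roy's criterion).** For `y ≠ 0` and `α` in a number
field `K ⊂ ℂ`, `α^d ≠ e^{dy}` for all `d ≥ 1` (`hermiteLindemann_via_roy`); in particular
`e^y ∉ K` (`cexp_not_mem_range_of_numberField`). Route: (a) ⇒ (b) (Roy's Proposition 2, PROVED
in the tree from Waldschmidt-type auxiliary polynomials) contradicts the theorem above. All
inputs are kernel-checked theorems of the tree (no named facts); the classical statement
"`e^y` transcendental for algebraic `y ≠ 0`" is the tree's `transcendental_exp_holds`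
(Lindemann–Weierstrass file), of which this is an independent proof route.  PRIORITY: a proof
of Hermite–Lindemann through the corresponding special case of Roy's conjecture is due to
Nguyen Ngoc Ai Van (2009) [Nguyen2009], who also extends the admissible parameter range of the
criterion; this file is an independent formalisation written without access to that paper
(statement known to us through the review Zbl 1276.11125 and [Waldschmidt2022, §8]).

References: D. Roy, Acta Arith. 97 (2001), Thm. 1, Prop. 2, condition (1) [Roy2001];
A. Baker, *Transcendental number theory* (1975), Ch. 1 Thm 1.2 (Hermite–Lindemann), Ch. 3 §3
[BakerTNT1975]; P. Philippon, Bull. SMF 114 (1986) [Philippon1986]; Nguyen Ngoc Ai Van,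
A refined criterion for Schanuel's conjecture, Chamchuri J. Math. 1 (2009), no. 2, 25–29
(Zbl 1276.11125) [Nguyen2009]; M. Waldschmidt, in *Mathematics Going Forward*, Lecture Notes in
Math. 2313, Springer (2022), §8 "Roy's Conjecture" [Waldschmidt2022].
-/

noncomputable section

open MvPolynomial Filter Complex
open Literature.NumberTheory.Transcendental

namespace Summit.Schanuel.Schanuel.Theorems

/-- **Condition (b) fails at algebraic points above Roy's threshold.** For `y₀, α₀` in a number
field with `σy₀ ≠ 0`, `σα₀ ≠ 0`, `0 ≤ t₀, t₁`, `t₀ + t₁ < s₀ + s₁`, (`σα₀` non-torsion or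
`t₁ < s₀`) and `u > max{1, s₀, t₀, s₁ + t₁}`, condition (b) of Roy's Theorem 1 fails.
(Philippon's zero estimate + Liouville's inequality.) [cite: Roy2001, Thm. 1 (b), Prop. 2;
BakerTNT1975, Ch. 3 §3] -/
theorem not_royConditionB_of_numberField {K : Type*} [Field K] [NumberField K] (σ : K →+* ℂ)
    (y₀ α₀ : K) (hy : σ y₀ ≠ 0) (hα : σ α₀ ≠ 0) {s₀ s₁ t₀ t₁ u : ℝ} (hs₀ : 0 ≤ s₀)
    (hs₁ : 0 ≤ s₁) (ht₀ : 0 ≤ t₀) (ht₁ : 0 ≤ t₁) (hsum : t₀ + t₁ < s₀ + s₁)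
    (htor : (∀ d : ℕ, 1 ≤ d → σ α₀ ^ d ≠ 1) ∨ t₁ < s₀) (hu1 : 1 < u) (hus₀ : s₀ < u)
    (hut₀ : t₀ < u) (hust : s₁ + t₁ < u) :
    ¬ RoyConditionB (σ y₀) (σ α₀) s₀ s₁ t₀ t₁ u := by
  intro hb
  classical
  obtain ⟨by_, hby, hyint⟩ := royLiou_exists_den y₀
  obtain ⟨bα, hbα, hαint⟩ := royLiou_exists_den α₀
  obtain ⟨Cy, hCy0, hCy⟩ : ∃ C : ℝ, 0 ≤ C ∧ ∀ φ : K →+* ℂ, ‖φ y₀‖ ≤ C :=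
    ⟨∑ φ : K →+* ℂ, ‖φ y₀‖, Finset.sum_nonneg fun _ _ => norm_nonneg _, fun φ =>
      Finset.single_le_sum (f := fun ψ : K →+* ℂ => ‖ψ y₀‖) (fun _ _ => norm_nonneg _)
        (Finset.mem_univ φ)⟩
  obtain ⟨Cα, hCα1, hCα⟩ : ∃ C : ℝ, 1 ≤ C ∧ ∀ φ : K →+* ℂ, ‖φ α₀‖ ≤ C :=
    ⟨max 1 (∑ φ : K →+* ℂ, ‖φ α₀‖), le_max_left _ _, fun φ =>
      (Finset.single_le_sum (f := fun ψ : K →+* ℂ => ‖ψ α₀‖) (fun _ _ => norm_nonneg _)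
        (Finset.mem_univ φ)).trans (le_max_right _ _)⟩
  have hdpos : 0 < Module.finrank ℚ K := Module.finrank_pos
  have hd0 : (0 : ℝ) ≤ (Module.finrank ℚ K : ℝ) := by positivity
  obtain ⟨ε, hε0, hεd⟩ : ∃ ε : ℝ, 0 < ε ∧ 20 * (Module.finrank ℚ K : ℝ) * ε = 1 :=
    ⟨1 / (20 * (Module.finrank ℚ K : ℝ)), by positivity, by field_simp⟩
  have hLy : 0 ≤ Real.log (Cy + 1) := Real.log_nonneg (by linarith)
  have hLα : 0 ≤ Real.log Cα := Real.log_nonneg hCα1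
  have hlby : 0 ≤ Real.log (by_ : ℝ) := Real.log_nonneg (by exact_mod_cast hby)
  have hlbα : 0 ≤ Real.log (bα : ℝ) := Real.log_nonneg (by exact_mod_cast hbα)
  have hts : t₁ + s₁ < u := by linarith
  have ht₁u : t₁ < u := by linarith
  -- the growth bookkeeping, in a real variable
  have H : ∀ᶠ x : ℝ in atTop,
      Real.log (by_ : ℝ) * x ^ t₀ ≤ ε * x ^ u ∧ Real.log (bα : ℝ) * x ^ (t₁ + s₁) ≤ ε * x ^ u ∧
      s₀ * x ^ s₀ * Real.log x ≤ ε * x ^ u ∧ 1 * x ^ t₀ ≤ ε * x ^ u ∧ 1 * x ^ t₁ ≤ ε * x ^ u ∧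
      1 * x ^ (1 : ℝ) ≤ ε * x ^ u ∧ Real.log (Cy + 1) * x ^ t₀ ≤ ε * x ^ u ∧
      s₁ * x ^ t₀ * Real.log x ≤ ε * x ^ u ∧ Real.log Cα * x ^ (t₁ + s₁) ≤ ε * x ^ u :=
    (eventually_mul_rpow_le_mul_rpow _ hut₀ hε0).and
      ((eventually_mul_rpow_le_mul_rpow _ hts hε0).and
      ((eventually_mul_rpow_mul_log_le hus₀ hs₀ hε0).and
      ((eventually_mul_rpow_le_mul_rpow _ hut₀ hε0).and
      ((eventually_mul_rpow_le_mul_rpow _ ht₁u hε0).and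
      ((eventually_mul_rpow_le_mul_rpow _ hu1 hε0).and
      ((eventually_mul_rpow_le_mul_rpow _ hut₀ hε0).and
      ((eventually_mul_rpow_mul_log_le hut₀ hs₁ hε0).and
      (eventually_mul_rpow_le_mul_rpow _ hts hε0))))))))
  obtain ⟨N, ⟨Q, hQ0, hd0', hd1', hH, hsmall⟩, hne, ⟨e1, e2, e3, e4, e5, e6, e7, e8, e9⟩, hN1⟩ :=
    (hb.and ((roy_no_exact_witness hy hα ht₀ ht₁ hsum htor).and
      ((tendsto_natCast_atTop_atTop.eventually H).and (eventually_ge_atTop 1)))).exists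
  obtain ⟨k, m, hk, hm, hx⟩ := hne Q hQ0 hd0' hd1'
  have hxle := hsmall k m hk hm
  set x : ℝ := (N : ℝ) with hxN
  have hx1 : (1 : ℝ) ≤ x := by rw [hxN]; exact_mod_cast hN1
  have hx0 : 0 < x := by linarith
  have hlogx : 0 ≤ Real.log x := Real.log_nonneg hx1
  have hxpow0 : ∀ a : ℝ, 0 ≤ x ^ a := fun a => Real.rpow_nonneg hx0.le a
  -- integer degree bounds
  set T₀ : ℕ := ⌊x ^ t₀⌋₊ with hT₀
  set T₁ : ℕ := ⌊x ^ t₁⌋₊ with hT₁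
  have hQT₀ : Q.degreeOf 0 ≤ T₀ := Nat.le_floor hd0'
  have hQT₁ : Q.degreeOf 1 ≤ T₁ := Nat.le_floor hd1'
  have hT₀x : (T₀ : ℝ) ≤ x ^ t₀ := Nat.floor_le (hxpow0 _)
  have hT₁x : (T₁ : ℝ) ≤ x ^ t₁ := Nat.floor_le (hxpow0 _)
  -- Liouville's inequality for `x = (D^k Q)(m σy₀, σα₀^m)`
  have hL := royD_value_liouville σ y₀ α₀ hby hbα hyint hαint hCy hCα hCy0 hCα1 Q hQT₀ hQT₁
    k m hx
  -- bounds for the individual terms of the exponent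
  have b1 : (T₀ : ℝ) * Real.log (by_ : ℝ) ≤ Real.log (by_ : ℝ) * x ^ t₀ := by
    rw [mul_comm]; exact mul_le_mul_of_nonneg_left hT₀x hlby
  have b2 : (T₁ : ℝ) * ((m : ℝ) * Real.log (bα : ℝ)) ≤ Real.log (bα : ℝ) * x ^ (t₁ + s₁) := by
    rw [Real.rpow_add hx0]
    calc (T₁ : ℝ) * ((m : ℝ) * Real.log (bα : ℝ)) ≤ x ^ t₁ * (x ^ s₁ * Real.log (bα : ℝ)) :=
          mul_le_mul hT₁x (mul_le_mul_of_nonneg_right hm hlbα) (by positivity) (hxpow0 _)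
      _ = Real.log (bα : ℝ) * (x ^ t₁ * x ^ s₁) := by ring
  have b3 : (k : ℝ) * Real.log (k : ℝ) ≤ s₀ * x ^ s₀ * Real.log x := by
    rcases Nat.eq_zero_or_pos k with hk0 | hk0
    · subst hk0
      have : 0 ≤ s₀ * x ^ s₀ * Real.log x := by
        have := hxpow0 s₀; positivity
      simpa using this
    · have hk1 : (1 : ℝ) ≤ k := by exact_mod_cast hk0
      have hlogk : Real.log (k : ℝ) ≤ s₀ * Real.log x := by
        rw [← Real.log_rpow hx0]; exact Real.log_le_log (by positivity) hk
      calc (k : ℝ) * Real.log (k : ℝ) ≤ x ^ s₀ * (s₀ * Real.log x) :=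
            mul_le_mul hk hlogk (Real.log_nonneg hk1) (hxpow0 _)
        _ = s₀ * x ^ s₀ * Real.log x := by ring
  have b5 : Real.log (max 1 (mvPolyHeight Q : ℝ)) ≤ x := by
    rw [Real.log_le_iff_le_exp (by positivity)]
    exact max_le (by have := Real.add_one_le_exp x; linarith) hH
  have b6 : (T₀ : ℝ) * Real.log ((m : ℝ) * Cy + 1) ≤
      Real.log (Cy + 1) * x ^ t₀ + s₁ * x ^ t₀ * Real.log x := by
    have hx1' : 1 ≤ x ^ s₁ := Real.one_le_rpow hx1 hs₁
    have hle : (m : ℝ) * Cy + 1 ≤ (Cy + 1) * x ^ s₁ := by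
      nlinarith [mul_le_mul_of_nonneg_right hm hCy0]
    have hlog : Real.log ((m : ℝ) * Cy + 1) ≤ Real.log (Cy + 1) + s₁ * Real.log x := by
      have h := Real.log_le_log (by positivity) hle
      rwa [Real.log_mul (by positivity) (by positivity), Real.log_rpow hx0] at h
    have hlog0 : 0 ≤ Real.log ((m : ℝ) * Cy + 1) :=
      Real.log_nonneg (le_add_of_nonneg_left (by positivity))
    calc (T₀ : ℝ) * Real.log ((m : ℝ) * Cy + 1)
        ≤ x ^ t₀ * (Real.log (Cy + 1) + s₁ * Real.log x) :=
          mul_le_mul hT₀x hlog hlog0 (hxpow0 _)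
      _ = Real.log (Cy + 1) * x ^ t₀ + s₁ * x ^ t₀ * Real.log x := by ring
  have b7 : (T₁ : ℝ) * ((m : ℝ) * Real.log Cα + 1) ≤ Real.log Cα * x ^ (t₁ + s₁) + x ^ t₁ := by
    rw [Real.rpow_add hx0]
    calc (T₁ : ℝ) * ((m : ℝ) * Real.log Cα + 1) ≤ x ^ t₁ * (x ^ s₁ * Real.log Cα + 1) :=
          mul_le_mul hT₁x (by gcongr) (by positivity) (hxpow0 _)
      _ = Real.log Cα * (x ^ t₁ * x ^ s₁) + x ^ t₁ := by ring
  have e6' : x ≤ ε * x ^ u := by simpa [Real.rpow_one] using e6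
  -- the exponent is `≤ N^u / 2`
  have s1 := b1.trans e1
  have s2 := b2.trans e2
  have s3 := b3.trans e3
  have s4 : (T₀ : ℝ) + T₁ ≤ 2 * (ε * x ^ u) := by linarith [hT₀x, hT₁x, e4, e5]
  have s5 := b5.trans e6'
  have s6 : (T₀ : ℝ) * Real.log ((m : ℝ) * Cy + 1) ≤ 2 * (ε * x ^ u) := by
    linarith [b6, e7, e8]
  have s7 : (T₁ : ℝ) * ((m : ℝ) * Real.log Cα + 1) ≤ 2 * (ε * x ^ u) := by
    linarith [b7, e9, e5]
  have hS : ((T₀ : ℝ) * Real.log (by_ : ℝ) + T₁ * ((m : ℝ) * Real.log (bα : ℝ))) +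
      ((k : ℝ) * Real.log (k : ℝ) + ((T₀ : ℝ) + T₁) + Real.log (max 1 (mvPolyHeight Q : ℝ)) +
        T₀ * Real.log ((m : ℝ) * Cy + 1) + T₁ * ((m : ℝ) * Real.log Cα + 1)) ≤
      10 * (ε * x ^ u) :=
    (add_le_add (add_le_add s1 s2)
      (add_le_add (add_le_add (add_le_add (add_le_add s3 s4) s5) s6) s7)).trans (le_of_eq (by ring))
  have hdS := mul_le_mul_of_nonneg_left hS hd0
  have hval : (Module.finrank ℚ K : ℝ) * (10 * (ε * x ^ u)) = x ^ u / 2 := by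
    linear_combination (x ^ u / 2) * hεd
  -- contradiction with `|x| ≤ e^{-N^u}`
  have h1 := hL.trans hxle
  rw [Real.exp_le_exp] at h1
  have hxupos : 0 < x ^ u := Real.rpow_pos_of_pos hx0 u
  linarith

/-- **Condition (b) fails at algebraic points for every admissible parameter set** of Roy's
Theorem 1. [cite: Roy2001, Thm. 1 and (1)] -/
theorem not_royConditionB_of_numberField_admissible {K : Type*} [Field K] [NumberField K]
    (σ : K →+* ℂ) (y₀ α₀ : K) (hy : σ y₀ ≠ 0) (hα : σ α₀ ≠ 0) {s₀ s₁ t₀ t₁ u : ℝ}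
    (h : RoyAdmissible s₀ s₁ t₀ t₁ u) : ¬ RoyConditionB (σ y₀) (σ α₀) s₀ s₁ t₀ t₁ u := by
  obtain ⟨hs₀, hs₁, ht₀, ht₁, _, hmax, hlow, _⟩ := h
  have hm := max_lt_iff.1 hmax
  have hm' := max_lt_iff.1 hm.2
  have h1s₀ : 1 < s₀ := lt_of_lt_of_le hm.1 (min_le_left _ _)
  have ht₀s₀ : t₀ < s₀ := lt_of_lt_of_le hm'.1 (min_le_left _ _)
  have h2t₁s₀ : 2 * t₁ < s₀ := lt_of_lt_of_le hm'.2 (min_le_left _ _)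
  have h2t₁s₁ : 2 * t₁ < 2 * s₁ := lt_of_lt_of_le hm'.2 (min_le_right _ _)
  have hs₀u : s₀ < u := lt_of_le_of_lt (le_max_left _ _) hlow
  have hst : s₁ + t₁ < u := lt_of_le_of_lt (le_max_right _ _) hlow
  exact not_royConditionB_of_numberField σ y₀ α₀ hy hα hs₀.le hs₁.le ht₀.le ht₁.le (by linarith)
    (Or.inr (by linarith)) (by linarith) hs₀u (by linarith) hst

/-- **Hermite–Lindemann through Roy's criterion.** For `y₀ ≠ 0` and `α₀` in a number field,
`σα₀^d ≠ e^{d σy₀}` for every `d ≥ 1`: otherwise (a) holds, Roy's Proposition 2 ((a) ⇒ (b),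
PROVED in the tree, parameters `(6/5, 7/10, 1, 1/2, 61/50)`) gives (b), contradicting
`not_royConditionB_of_numberField`.  First obtained (on paper) by Nguyen (2009).
[cite: BakerTNT1975, Ch. 1 Thm. 1.2 (Hermite–Lindemann); Roy2001, Prop. 2; Nguyen2009] -/
theorem hermiteLindemann_via_roy {K : Type*} [Field K] [NumberField K] (σ : K →+* ℂ)
    (y₀ α₀ : K) (hy : y₀ ≠ 0) (d : ℕ) (hd : 1 ≤ d) : σ α₀ ^ d ≠ cexp (d * σ y₀) := by
  intro h
  have hy' : σ y₀ ≠ 0 := (map_ne_zero σ).mpr hy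
  have hα : σ α₀ ≠ 0 := by
    intro h0
    rw [h0, zero_pow (by omega)] at h
    exact Complex.exp_ne_zero _ h.symm
  have ha : RoyConditionA (σ y₀) (σ α₀) := ⟨d, hd, h⟩
  have hb := Roy2001_prop2_holds (σ y₀) (σ α₀) hα (6 / 5) (7 / 10) 1 (1 / 2) (61 / 50)
    (by norm_num) (by norm_num) (by norm_num) (by norm_num) (by norm_num)
    (by norm_num [max_lt_iff]) (by norm_num) ha
  exact not_royConditionB_of_numberField σ y₀ α₀ hy' hα (by norm_num) (by norm_num)
    (by norm_num) (by norm_num) (by norm_num) (Or.inr (by norm_num)) (by norm_num) (by norm_num)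
    (by norm_num) (by norm_num) hb

/-- **`e^y ∉ K`** for `y ≠ 0` in the number field `K ⊂ ℂ`. [cite: BakerTNT1975, Ch. 1 Thm. 1.2] -/
theorem cexp_not_mem_range_of_numberField {K : Type*} [Field K] [NumberField K] (σ : K →+* ℂ)
    (y₀ : K) (hy : y₀ ≠ 0) : cexp (σ y₀) ∉ Set.range σ := by
  rintro ⟨α₀, hα₀⟩
  exact hermiteLindemann_via_roy σ y₀ α₀ hy 1 le_rfl (by simp [hα₀])

end Summit.Schanuel.Schanuel.Theorems

end
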